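import Summits.BirchSwinnertonDyer.BirchSwinnertonDyer.Theorems.PrintCf2RamifiedOffTYZRealRedeiKernel
import Summits.BirchSwinnertonDyer.BirchSwinnertonDyer.Theorems.PrintCf2RamifiedOffTYZQFormDefs
import Literature.NumberTheory.EllipticCurves.Smith2016.CongruentNumberRedeiDeterminant
import HarnessLib

/-!
# Crux `PrintCf2.RamifiedOffTYZOfFacts` (stmt-BirchSwinnertonDyer-20509), line `offtyz-v7`, LEAD cycle 8 (cruxlead-20509 g7):
# KERNEL COUNTS — the Rédei kernel of `−4d` with the prime `2` deleted, the kernel of Monsky's `A_d`, and the kernel of the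
# REAL Rédei matrix `N_d = A_d + D₋₁` all have the same size; kernel sums; the «functional killing the rows» lemma

Pure `𝔽₂` linear algebra (THEOREMS ONLY; no `def`, no named fact, no `sorry`), `--supports stmt-BirchSwinnertonDyer-20509`.
For a tuple `p : Fin k → ℕ` of distinct odd primes with `d = ∏ pᵢ ≡ 1 (mod 4)` (an even number of `pᵢ ≡ 3 (mod 4)`):
* §1 `card_ker_transpose_eq` (`#ker Mᵀ = #ker M`, rank–nullity + `rank Mᵀ = rank M`); `card_ker_realRedei_eq_card_ker_legendreMatrix`
  (`#ker N = #ker A`, via the twist bijection `u ↦ u + (c·u)𝟙 : ker Aᵀ → ker N` of `MonskyRedeiForm.transpose_mulVec_eq_zero_iff`).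
* §2 `card_redeiKernelTwo_eq_card_ker_legendreMatrix`: for the prime tuple `(2; p₁, …, p_k)` of `d_K = −4d`,
  `#{e ∈ 𝔽₂^{k+1} : RM(−4d)ᵀ e = 0 ∧ e₂ = 0} = #ker A` (`e = (0; u)`: the odd rows of `RM(−4d)ᵀ e` are `A u`, the row of `2` is
  `Σ_b (A u)_b` since the rows of `RM` sum to zero) — so ty2's `fourTwoCard (Pic 𝒪₂) = #{…}` (p680375/p681123) reads `= #ker N`.
* §3 kernel sums (`QForm.kerSum`): `= λ` when `ker = {0, λ}` (`kerSum_eq_of_ker_pair`), `= 0` when `#ker ≠ 2` (`kerSum_eq_zero_of_card_ne_two`);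
  `#ker = 2 ⟹ ker = {0, kerSum}` (`ker_iff_of_card_eq_two`).
* §4 `addMonoidHom_eq_zero_or_eq_dotProduct`: an additive `δ : 𝔽₂^k → 𝔽₂` vanishing on every ROW of a square matrix `N` with
  `ker N = {0, λ}` is `0` or `v ↦ λ·v` (the row space has `𝔽₂`-codimension one and annihilator `{0, λ}`).
These feed `…MoverBlockForm` (the block character of the squared Galois action = `kerSum N_d · x`).  BSD is not proved by any of this.

References: [cite: Stevenhagen1995RedeiMatrices, §2 Thm. 1 (proof)]; [cite: LiMa2008, Def. 0.2]; [cite: HeathBrown1994SelmerCongruentII,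
Appendix (Monsky), typescript p. 39 L13–L26]; crux note `Lines/offtyz_v7_QForm.md` §2, §11.
-/

noncomputable section

open scoped Classical

open Finset Matrix Literature.NumberTheory.EllipticCurves.HeathBrown1994
  Literature.NumberTheory.EllipticCurves.Smith2016 Literature.NumberTheory.QuadraticFields
  Literature.NumberTheory.QuadraticFields.RedeiReichardt
  Summit.BirchSwinnertonDyer.PrintCf2.MonskyRedeiForm Summit.BirchSwinnertonDyer.PrintCf2.QForm

set_option autoImplicit false

namespace Summit.BirchSwinnertonDyer.PrintCf2.MoverAssembly

variable {k : ℕ}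

/-! ## §1 `#ker Mᵀ = #ker M`; `#ker N = #ker A` -/

/-- Over `𝔽₂`, a square matrix and its transpose have kernels of the same size (`2^{t − rank}`, `rank Mᵀ = rank M`).
[cite: Stevenhagen1995RedeiMatrices, §2 proof of Thm. 1 (display (2))] -/
theorem card_ker_transpose_eq (M : Matrix (Fin k) (Fin k) (ZMod 2)) :
    Fintype.card {v : Fin k → ZMod 2 // Mᵀ *ᵥ v = 0} = Fintype.card {v : Fin k → ZMod 2 // M *ᵥ v = 0} := by
  rw [card_ker_mulVec_eq, card_ker_mulVec_eq, Matrix.rank_transpose]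

variable (p : Fin k → ℕ) (hp : ∀ i, (p i).Prime) (hodd : ∀ i, Odd (p i)) (hinj : Function.Injective p)

include hp hodd hinj in
/-- **`#ker N = #ker A`** for Monsky's `A` and the real Rédei matrix `N = A + D₋₁` of a tuple of distinct odd primes with an EVEN number of
`pᵢ ≡ 3 (mod 4)` (`Σ (−1/pᵢ)₊ = 0`): `u ↦ u + (c·u)·𝟙` is a bijection `ker Aᵀ → ker N` (`Aᵀ = N + ccᵀ`, `N𝟙 = c`, `c·𝟙 = 0`), and
`#ker Aᵀ = #ker A`. [cite: HeathBrown1994SelmerCongruentII, Appendix (Monsky), typescript p. 39 L13–L26] [cite: Stevenhagen1995RedeiMatrices, §2] -/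
theorem card_ker_realRedei_eq_card_ker_legendreMatrix (hc : (∑ i, addLegendreSym (-1) (p i)) = 0) :
    Fintype.card {v : Fin k → ZMod 2 // (legendreMatrix p + legendreDiagonal p (-1)) *ᵥ v = 0} =
      Fintype.card {v : Fin k → ZMod 2 // legendreMatrix p *ᵥ v = 0} := by
  have hp2 : ∀ i, p i ≠ 2 := ne_two_of_odd p hodd
  rw [← card_ker_transpose_eq (legendreMatrix p)]
  set c : Fin k → ZMod 2 := fun i => addLegendreSym (-1) (p i) with hcdef
  set N := legendreMatrix p + legendreDiagonal p (-1) with hNdef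
  have hc1 : c ⬝ᵥ (fun _ => (1 : ZMod 2)) = 0 := by simp only [dotProduct, mul_one]; exact hc
  have htwist_dot : ∀ u : Fin k → ZMod 2, c ⬝ᵥ (u + (c ⬝ᵥ u) • (fun _ => (1 : ZMod 2))) = c ⬝ᵥ u := by
    intro u; rw [dotProduct_add, dotProduct_smul, hc1, smul_zero, add_zero]
  have hvv : ∀ w : Fin k → ZMod 2, w + w = 0 := fun w => funext fun i => CharTwo.add_self_eq_zero (w i)
  have hinvol : ∀ u : Fin k → ZMod 2,
      (u + (c ⬝ᵥ u) • (fun _ => (1 : ZMod 2))) + (c ⬝ᵥ (u + (c ⬝ᵥ u) • (fun _ => (1 : ZMod 2)))) •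
        (fun _ => (1 : ZMod 2)) = u := by
    intro u; rw [htwist_dot, add_assoc, hvv, add_zero]
  have hN1 : N *ᵥ (fun _ => (1 : ZMod 2)) = c := realRedei_mulVec_one p
  have hmem : ∀ u : Fin k → ZMod 2, (legendreMatrix p)ᵀ *ᵥ u = 0 ↔
      N *ᵥ (u + (c ⬝ᵥ u) • (fun _ => (1 : ZMod 2))) = 0 := by
    intro u
    rw [transpose_mulVec_eq_zero_iff p hp hp2 hinj u, ← hNdef, ← hcdef, mulVec_add, mulVec_smul, hN1]
    constructor
    · intro h; rw [h, hvv]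
    · intro h; rw [← vec_add_eq_zero_iff]; exact h
  symm
  refine Fintype.card_congr
    { toFun := fun u => ⟨u.1 + (c ⬝ᵥ u.1) • (fun _ => (1 : ZMod 2)), (hmem u.1).mp u.2⟩
      invFun := fun v => ⟨v.1 + (c ⬝ᵥ v.1) • (fun _ => (1 : ZMod 2)), by rw [hmem, hinvol]; exact v.2⟩
      left_inv := fun u => Subtype.ext (hinvol u.1)
      right_inv := fun v => Subtype.ext (hinvol v.1) }

/-! ## §2 The conductor-two Rédei kernel `{e : RM(−4d)ᵀ e = 0, e₂ = 0}` is the kernel of `A` -/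

include hp hodd hinj in
/-- **`RM(−4d)ᵀ (0; u) = 0 ⟺ A u = 0`** for the prime tuple `(2; p₁, …, p_k)` of `d_K = −4d`, `d = ∏ pᵢ ≡ 1 (mod 4)`: the odd coordinates
of `RM(−4d)ᵀ (0; u)` are those of `A u` (`redeiMatrix_cons_two_apply_succ`), and the coordinate of `2` is their sum (rows of `RM` sum
to zero). [cite: LiMa2008, Def. 0.2 (p. 279)] [cite: Stevenhagen1995RedeiMatrices, §2 Thm. 1] -/
theorem redeiMatrix_transpose_mulVec_cons_zero_eq_zero_iff (h4 : (∏ i, p i) % 4 = 1) (u : Fin k → ZMod 2) :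
    (redeiMatrix (∏ i, p i) (Fin.cons 2 p))ᵀ *ᵥ (Fin.cons 0 u : Fin (k + 1) → ZMod 2) = 0 ↔
      legendreMatrix p *ᵥ u = 0 := by
  set RM := redeiMatrix (∏ i, p i) (Fin.cons 2 p) with hRM
  -- odd coordinates
  have hsucc : ∀ b : Fin k, (RMᵀ *ᵥ (Fin.cons 0 u : Fin (k + 1) → ZMod 2)) b.succ = (legendreMatrix p *ᵥ u) b := by
    intro b
    simp only [mulVec, dotProduct, transpose_apply]
    rw [Fin.sum_univ_succ, Fin.cons_zero, mul_zero, zero_add]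
    refine Finset.sum_congr rfl fun a _ => ?_
    rw [Fin.cons_succ, hRM, redeiMatrix_cons_two_apply_succ p hp hodd hinj h4 a.succ b, Fin.cases_succ]
  -- the coordinate of `2` is the sum of the odd coordinates
  have hzero : (RMᵀ *ᵥ (Fin.cons 0 u : Fin (k + 1) → ZMod 2)) 0 =
      ∑ b : Fin k, (RMᵀ *ᵥ (Fin.cons 0 u : Fin (k + 1) → ZMod 2)) b.succ := by
    -- `RM j 0 = Σ_b RM j b.succ` for every row `j`
    have hrow : ∀ j : Fin (k + 1), RM j 0 = ∑ b : Fin k, RM j b.succ := by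
      intro j
      have h0 := congr_fun (redeiMatrix_mulVec_one (∏ i, p i) (Fin.cons 2 p)) j
      rw [mulVec, dotProduct, Pi.zero_apply, Fin.sum_univ_succ] at h0
      simp only [mul_one] at h0
      have : ∀ x y : ZMod 2, x + y = 0 → x = y := by decide
      exact this _ _ h0
    simp only [mulVec, dotProduct, transpose_apply]
    rw [Finset.sum_comm]
    refine Finset.sum_congr rfl fun j _ => ?_
    rw [hrow j, Finset.sum_mul]
  constructor
  · intro h
    funext b
    rw [← hsucc b, h, Pi.zero_apply, Pi.zero_apply]
  · intro h
    funext j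
    refine Fin.cases ?_ (fun b => ?_) j
    · rw [hzero, Pi.zero_apply]
      exact Finset.sum_eq_zero fun b _ => by rw [hsucc b, h, Pi.zero_apply]
    · rw [hsucc b, h, Pi.zero_apply, Pi.zero_apply]

include hp hodd hinj in
/-- **`#{e : RM(−4d)ᵀ e = 0 ∧ e₂ = 0} = #ker A`** (`d = ∏ pᵢ ≡ 1 (mod 4)`, tuple `(2; p₁, …, p_k)`, the prime `2` at index `0`).
[cite: Stevenhagen1995RedeiMatrices, §2 Thm. 1] [cite: LiMa2008, Def. 0.2 and Thm. 0.4] -/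
theorem card_redeiKernelTwo_eq_card_ker_legendreMatrix (h4 : (∏ i, p i) % 4 = 1) :
    Fintype.card {e : Fin (k + 1) → ZMod 2 //
        (redeiMatrix (∏ i, p i) (Fin.cons 2 p))ᵀ *ᵥ e = 0 ∧ e 0 = 0} =
      Fintype.card {u : Fin k → ZMod 2 // legendreMatrix p *ᵥ u = 0} := by
  refine Fintype.card_congr
    { toFun := fun e => ⟨Fin.tail e.1, ?_⟩
      invFun := fun u => ⟨Fin.cons 0 u.1,
        (redeiMatrix_transpose_mulVec_cons_zero_eq_zero_iff p hp hodd hinj h4 u.1).mpr u.2, Fin.cons_zero _ _⟩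
      left_inv := fun e => Subtype.ext ?_
      right_inv := fun u => Subtype.ext (by dsimp only; exact Fin.tail_cons (α := fun _ : Fin (k + 1) => ZMod 2) 0 u.1) }
  · have he : (Fin.cons 0 (Fin.tail e.1) : Fin (k + 1) → ZMod 2) = e.1 := by
      calc (Fin.cons 0 (Fin.tail e.1) : Fin (k + 1) → ZMod 2) = Fin.cons (e.1 0) (Fin.tail e.1) := by rw [e.2.2]
        _ = e.1 := Fin.cons_self_tail e.1
    have h := e.2.1
    rw [← he] at h
    exact (redeiMatrix_transpose_mulVec_cons_zero_eq_zero_iff p hp hodd hinj h4 _).mp h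
  · show Fin.cons 0 (Fin.tail e.1) = e.1
    calc (Fin.cons 0 (Fin.tail e.1) : Fin (k + 1) → ZMod 2) = Fin.cons (e.1 0) (Fin.tail e.1) := by rw [e.2.2]
      _ = e.1 := Fin.cons_self_tail e.1

include hp hodd hinj in
/-- **All three kernels have the same size**: `#{e : RM(−4d)ᵀ e = 0 ∧ e₂ = 0} = #ker N` for `d = ∏ pᵢ ≡ 1 (mod 4)`.
[cite: Stevenhagen1995RedeiMatrices, §2 Thm. 1] [cite: HeathBrown1994SelmerCongruentII, Appendix (Monsky), typescript p. 39 L13–L26] -/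
theorem card_redeiKernelTwo_eq_card_ker_realRedei (h4 : (∏ i, p i) % 4 = 1) :
    Fintype.card {e : Fin (k + 1) → ZMod 2 //
        (redeiMatrix (∏ i, p i) (Fin.cons 2 p))ᵀ *ᵥ e = 0 ∧ e 0 = 0} =
      Fintype.card {v : Fin k → ZMod 2 // (legendreMatrix p + legendreDiagonal p (-1)) *ᵥ v = 0} := by
  have hc : (∑ i, addLegendreSym (-1) (p i)) = 0 := by
    -- an even number of `pᵢ ≡ 3 (mod 4)` since `∏ pᵢ ≡ 1 (mod 4)`: `(−1/∏pᵢ)₊ = Σ (−1/pᵢ)₊`… read through `(d/·)`? use the product formula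
    -- for the multiplicative character `χ₄`: `∏ χ₄(pᵢ) = χ₄(d) = 1`.
    have key : ∀ (s : Finset (Fin k)), (∑ i ∈ s, addLegendreSym (-1) (p i)) =
        if (∏ i ∈ s, p i) % 4 = 3 then 1 else 0 := by
      intro s
      induction s using Finset.induction_on with
      | empty => simp
      | insert a s ha ih =>
        have hla : addLegendreSym (-1) (p a) = if p a % 4 = 3 then 1 else 0 := by
          by_cases h3 : p a % 4 = 3
          · rw [if_pos h3, (addLegendreSym_neg_one_eq_one_iff (hodd a)).mpr h3]
          · rw [if_neg h3, (addLegendreSym_neg_one_eq_zero_iff (hodd a)).mpr (by have := Nat.odd_iff.mp (hodd a); omega)]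
        rw [Finset.sum_insert ha, Finset.prod_insert ha, ih, hla]
        have hpa : p a % 4 = 1 ∨ p a % 4 = 3 := by have := Nat.odd_iff.mp (hodd a); omega
        have hs : (∏ i ∈ s, p i) % 4 = 1 ∨ (∏ i ∈ s, p i) % 4 = 3 := by
          have hso : Odd (∏ i ∈ s, p i) := Finset.prod_induction _ Odd (fun a b ha hb => ha.mul hb) odd_one (fun i _ => hodd i)
          have := Nat.odd_iff.mp hso; omega
        have hm : (p a * ∏ i ∈ s, p i) % 4 = (p a % 4) * ((∏ i ∈ s, p i) % 4) % 4 := Nat.mul_mod _ _ _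
        rcases hpa with h1 | h1 <;> rcases hs with h2 | h2 <;> simp only [hm, h1, h2] <;> decide
    rw [key, if_neg (by rw [h4]; decide)]
  rw [card_redeiKernelTwo_eq_card_ker_legendreMatrix p hp hodd hinj h4,
    card_ker_realRedei_eq_card_ker_legendreMatrix p hp hodd hinj hc]

/-! ## §3 Kernel sums -/

/-- **`kerSum M = λ` when `ker M = {0, λ}`.** [folklore] -/
theorem kerSum_eq_of_ker_pair {m : Type*} [Fintype m] [DecidableEq m] (M : Matrix m m (ZMod 2)) {v₀ : m → ZMod 2}
    (hv₀ : v₀ ≠ 0) (hker : ∀ w, M *ᵥ w = 0 ↔ w = 0 ∨ w = v₀) : kerSum M = v₀ := by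
  unfold kerSum
  have hK : (univ : Finset (m → ZMod 2)).filter (fun v => M *ᵥ v = 0) = {0, v₀} := by
    ext w
    simp only [mem_filter, mem_univ, true_and, mem_insert, mem_singleton]
    exact hker w
  rw [← Finset.sum_filter, hK, sum_pair (Ne.symm hv₀), zero_add]

/-- A finite additive subgroup of an `𝔽₂`-vector space of functions with a non-zero element has EVEN order (the translation by that
element is a fixed-point-free involution). [folklore] -/
theorem even_card_of_mem_ne_zero {m : Type*} [Fintype m] [DecidableEq m] (S : Finset (m → ZMod 2))
    (hadd : ∀ v ∈ S, ∀ w ∈ S, v + w ∈ S) {w : m → ZMod 2} (hw : w ∈ S) (hw0 : w ≠ 0) : Even S.card := by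
  -- the involution `v ↦ v + w` on `S` has no fixed point
  have hvv : ∀ v : m → ZMod 2, v + w + w = v := fun v => by
    rw [add_assoc, show w + w = 0 from funext fun i => CharTwo.add_self_eq_zero (w i), add_zero]
  classical
  -- count `S` in pairs: `Σ_{v ∈ S} 1 = 0` in `ZMod 2`
  have hsum : (∑ v ∈ S, (1 : ZMod 2)) = 0 := by
    refine Finset.sum_involution (fun v _ => v + w) (fun v _ => by decide) (fun v _ _ h => ?_) (fun v hv => hadd v hv w hw)
      (fun v _ => hvv v)
    exact hw0 (by simpa using h)
  rw [Finset.sum_const, nsmul_eq_mul, mul_one] at hsum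
  rw [Nat.even_iff]
  have := (ZMod.natCast_eq_zero_iff_even.mp hsum)
  exact Nat.even_iff.mp this

/-- **`kerSum M = 0` when `#ker M ≠ 2`.**  Coordinatewise: `(kerSum M)_α = #{v ∈ ker : v_α = 1} mod 2`; if this set is non-empty it is a
translate of the subgroup `{v ∈ ker : v_α = 0}`, which is `{0}` only when `#ker = 2`, and otherwise has even order. [folklore] -/
theorem kerSum_eq_zero_of_card_ne_two {m : Type*} [Fintype m] [DecidableEq m] (M : Matrix m m (ZMod 2))
    (hcard : Fintype.card {v : m → ZMod 2 // M *ᵥ v = 0} ≠ 2) : kerSum M = 0 := by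
  classical
  set K : Finset (m → ZMod 2) := univ.filter (fun v => M *ᵥ v = 0) with hKdef
  have hKmem : ∀ v, v ∈ K ↔ M *ᵥ v = 0 := fun v => by rw [hKdef, mem_filter]; simp
  have hKcard : K.card = Fintype.card {v : m → ZMod 2 // M *ᵥ v = 0} := by
    rw [hKdef, Fintype.card_subtype]
  have hKadd : ∀ v ∈ K, ∀ w ∈ K, v + w ∈ K := fun v hv w hw => by
    rw [hKmem] at hv hw ⊢; rw [mulVec_add, hv, hw, add_zero]
  have hK0 : (0 : m → ZMod 2) ∈ K := (hKmem 0).mpr (mulVec_zero M)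
  unfold kerSum
  rw [← Finset.sum_filter, ← hKdef]
  funext α
  rw [Finset.sum_apply, Pi.zero_apply]
  -- split `K` by the value at `α`
  set K₁ := K.filter (fun v => v α = 1) with hK₁
  set K₀ := K.filter (fun v => v α = 0) with hK₀
  have hval : ∀ x : ZMod 2, x = 0 ∨ x = 1 := by decide
  have hsplit : (∑ v ∈ K, v α) = (K₁.card : ZMod 2) := by
    rw [hK₁, Finset.natCast_card_filter]
    refine Finset.sum_congr rfl fun v _ => ?_
    rcases hval (v α) with h | h <;> simp [h]
  rw [hsplit, ZMod.natCast_eq_zero_iff_even]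
  by_cases hK₁e : K₁ = ∅
  · rw [hK₁e, card_empty]; exact ⟨0, rfl⟩
  · obtain ⟨w, hw⟩ := Finset.nonempty_iff_ne_empty.mpr hK₁e
    rw [hK₁, mem_filter] at hw
    -- `v ↦ v + w` is a bijection `K₀ → K₁`
    have hbij : K₁.card = K₀.card := by
      symm
      refine Finset.card_nbij' (fun v => v + w) (fun v => v + w) (fun v hv => ?_) (fun v hv => ?_)
        (fun v _ => ?_) (fun v _ => ?_)
      · rw [hK₀, mem_coe, mem_filter] at hv
        rw [hK₁, mem_coe, mem_filter]
        exact ⟨hKadd _ hv.1 _ hw.1, show (v + w) α = 1 by rw [Pi.add_apply, hv.2, hw.2, zero_add]⟩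
      · rw [hK₁, mem_coe, mem_filter] at hv
        rw [hK₀, mem_coe, mem_filter]
        exact ⟨hKadd _ hv.1 _ hw.1, show (v + w) α = 0 by rw [Pi.add_apply, hv.2, hw.2]; decide⟩
      · show v + w + w = v
        rw [add_assoc, show w + w = 0 from funext fun i => CharTwo.add_self_eq_zero (w i), add_zero]
      · show v + w + w = v
        rw [add_assoc, show w + w = 0 from funext fun i => CharTwo.add_self_eq_zero (w i), add_zero]
    rw [hbij]
    -- `K₀` is a subgroup; if it were `{0}` then `#K = 2`
    have hK₀add : ∀ v ∈ K₀, ∀ u ∈ K₀, v + u ∈ K₀ := fun v hv u hu => by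
      rw [hK₀, mem_filter] at hv hu ⊢
      exact ⟨hKadd _ hv.1 _ hu.1, by rw [Pi.add_apply, hv.2, hu.2, add_zero]⟩
    by_cases hex : ∃ u ∈ K₀, u ≠ 0
    · obtain ⟨u, hu, hu0⟩ := hex
      exact even_card_of_mem_ne_zero K₀ hK₀add hu hu0
    · push Not at hex
      exfalso
      apply hcard
      have hK₀eq : K₀ = {0} := by
        ext v
        rw [mem_singleton]
        constructor
        · exact fun hv => hex v hv
        · rintro rfl; rw [hK₀, mem_filter]; exact ⟨hK0, rfl⟩
      have hKsplit : K.card = K₀.card + K₁.card := by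
        have h := Finset.card_filter_add_card_filter_not (s := K) (fun v => v α = 0)
        have hneg : K.filter (fun v => ¬ v α = 0) = K₁ := by
          rw [hK₁]
          refine Finset.filter_congr fun v _ => ?_
          rcases hval (v α) with h0 | h1
          · rw [h0]; decide
          · rw [h1]; decide
        rw [hneg, ← hK₀] at h
        exact h.symm
      rw [← hKcard, hKsplit, hbij, hK₀eq, card_singleton]

/-- **`#ker M = 2 ⟹ ker M = {0, kerSum M}` and `kerSum M ≠ 0`.** [folklore] -/
theorem ker_iff_of_card_eq_two {m : Type*} [Fintype m] [DecidableEq m] (M : Matrix m m (ZMod 2))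
    (hcard : Fintype.card {v : m → ZMod 2 // M *ᵥ v = 0} = 2) :
    kerSum M ≠ 0 ∧ ∀ w, M *ᵥ w = 0 ↔ w = 0 ∨ w = kerSum M := by
  classical
  have h0 : M *ᵥ (0 : m → ZMod 2) = 0 := mulVec_zero M
  rw [← Nat.card_eq_fintype_card, Nat.card_eq_two_iff' (⟨0, h0⟩ : {v : m → ZMod 2 // M *ᵥ v = 0})] at hcard
  obtain ⟨y, hy0, huniq⟩ := hcard
  have hv₀0 : y.1 ≠ 0 := fun h => hy0 (Subtype.ext h)
  have hker : ∀ w, M *ᵥ w = 0 ↔ w = 0 ∨ w = y.1 := by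
    intro w
    constructor
    · intro hw
      by_cases hw0 : w = 0
      · exact Or.inl hw0
      · right
        have := huniq ⟨w, hw⟩ (fun h => hw0 (congrArg Subtype.val h))
        exact congrArg Subtype.val this
    · rintro (rfl | rfl); exacts [h0, y.2]
  have hks : kerSum M = y.1 := kerSum_eq_of_ker_pair M hv₀0 hker
  rw [hks]
  exact ⟨hv₀0, hker⟩

/-! ## §4 An additive functional killing the rows of a matrix with a two-element kernel -/

/-- **An additive `δ : 𝔽₂^k → 𝔽₂` vanishing on every ROW of `N`, where `ker N = {0, λ}`, is either `0` or `v ↦ λ·v`.**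
(`δ v = μ·v` with `μᵢ = δ(eᵢ)`; `δ(row_j N) = (N μ)_j`, so `N μ = 0` and `μ ∈ {0, λ}`.) [folklore] -/
theorem addMonoidHom_eq_zero_or_eq_dotProduct (N : Matrix (Fin k) (Fin k) (ZMod 2)) {v₀ : Fin k → ZMod 2}
    (hker : ∀ w, N *ᵥ w = 0 ↔ w = 0 ∨ w = v₀) (δ : (Fin k → ZMod 2) →+ ZMod 2) (hrows : ∀ j, δ (N j) = 0) :
    (∀ v, δ v = 0) ∨ (∀ v, δ v = v₀ ⬝ᵥ v) := by
  set μ : Fin k → ZMod 2 := fun i => δ (Pi.single i 1) with hμ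
  -- `δ v = μ · v`
  have hδ : ∀ v, δ v = μ ⬝ᵥ v := by
    intro v
    conv_lhs => rw [show v = ∑ i, Pi.single i (v i) from (Finset.univ_sum_single v).symm]
    rw [map_sum, dotProduct]
    refine Finset.sum_congr rfl fun i _ => ?_
    have hval : ∀ x : ZMod 2, x = 0 ∨ x = 1 := by decide
    rcases hval (v i) with h | h
    · rw [h, Pi.single_zero, map_zero, mul_zero]
    · rw [h, mul_one]
  -- `N μ = 0`
  have hNμ : N *ᵥ μ = 0 := by
    funext j
    rw [Pi.zero_apply, ← hrows j, hδ]
    simp only [mulVec, dotProduct]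
    exact Finset.sum_congr rfl fun i _ => mul_comm _ _
  rcases (hker μ).mp hNμ with h | h
  · left; intro v; rw [hδ, h, zero_dotProduct]
  · right; intro v; rw [hδ, h]

end Summit.BirchSwinnertonDyer.PrintCf2.MoverAssembly

end
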